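import Literature.AlgebraicGeometry.Resolution.MonoidalEFReduction
import Literature.AlgebraicGeometry.Resolution.ArtinApproximationAffineLemmas
import Mathlib.RingTheory.AdicCompletion.LocalRing
import HarnessLib

/-!
# Values of the formal completion under an extension of a rank-one dominating valuation

Topic: `Literature/AlgebraicGeometry/Resolution` (proofs only; no new notions, no new named
facts). Commutative algebra behind two sentences of Cossart–Piltant's descent of local
uniformization from the formal completion (V. Cossart, O. Piltant, *Resolution of singularities
of arithmetical threefolds*, J. Algebra 529 (2019) = arXiv:1412.0868, proof of journal Prop. 4.8
= v1 Prop. 4.6, p. 53): "Note that `dim 𝒪_v̂ ≥ 1` and that inequality is strict in general" /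
"Note that it is not necessary to assume here that `dim 𝒪_v̂ = 1` because `h ∈ A`", and
"Since `A` is dense in `Â` for the `m_A`-adic topology …" ((511)–(512)). Let `(A, 𝔪)` be a
Noetherian local ring, `K` a field over `A`, `O` a RANK-ONE valuation ring of `K` containing the
image of `A` and centred on `𝔪`, `ι : K → K₁` a ring map compatible with `A → Â → K₁`, and `O'`
a valuation ring of `K₁` containing the image of `Â` with `O' ∩ K = O` (an extension `v̂` of
`v`). Then:

* `exists_forall_mem_pow_valuation_lt` — **`v(𝔪ⁿ) → ∞`**: for every `b ∈ K`, `b ≠ 0`, some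
  power `𝔪ⁿ` has all its elements of `v`-value beyond `v(b)` (rank one + domination + `𝔪`
  finitely generated);
* `valuation_adicCompletion_eq_or_lt` — **dichotomy for the values of `Â`**: every `x ∈ Â` has
  `v̂(x) = v(a)` for some `a ∈ A` (density: `x ≡ a mod 𝔪̂ⁿ` with `v̂(𝔪̂ⁿ) > v̂(x)`), OR `v̂(x)`
  exceeds `v(b)` for every `b ∈ K^×` (`x` is "infinitely close to the support of `v̂`"; these
  are the elements responsible for `dim 𝒪_v̂ > dim 𝒪_v`). In particular the values of the
  elements of `A`, e.g. of `h ∈ A` in Lemma 4.7, are archimedean-comparable with all finite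
  values of `Â` — the mechanism behind "because `h ∈ A`";
* `exists_isPrime_valuation_adicCompletion_lt_forall` — the elements of infinitely large value form a
  prime ideal of `Â` containing the kernel of `Â → K₁` and meeting `A` in `ker (A → K)` only;
* `exists_pow_valuation_div_le_of_finite_denominator` — archimedean comparability of `v̂(x₁/x₂)`
  with every `v(c)`, `c ∈ K^×`, when the denominator `x₂` is `K`-finite (the `E = F` loop input).

Mathlib's multiplicative convention: `v(y) > v(b)` in the source is `valuation y < valuation b`.

## Sources

* V. Cossart, O. Piltant, J. Algebra 529 (2019) 268–535 = arXiv:1412.0868, proof of Prop. 4.8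
  with Lemma 4.7 (arXiv v1: Prop. 4.6, p. 53). [CossartPiltant2019]
* O. Zariski, P. Samuel, *Commutative Algebra* II, Ch. VI §§ 10, 13 (rank one valuations are
  real-valued; values on a dominated local ring). [folklore]
-/

noncomputable section

namespace Literature.AlgebraicGeometry.Resolution

universe u v w

open IsLocalRing

variable {A : Type u} [CommRing A] [IsLocalRing A] [IsNoetherianRing A]
  {K : Type v} [Field K] [Algebra A K]

/-- **`v(𝔪ⁿ) → ∞` for a rank-one valuation centred on `𝔪`.** Let `(A, 𝔪)` be a Noetherian local
ring mapping into a rank-one valuation ring `O` of a field `K`, with `v(x) < 1` for `x ∈ 𝔪`. Then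
for every `b ≠ 0` in `K` there is `n` with `v(y) < v(b)` for all `y ∈ 𝔪ⁿ`: if `𝔪 = (g₁, …, g_k)`
and `c = max v(gᵢ) < 1`, then `v(𝔪ⁿ) ≤ cⁿ`, and `cⁿ < v(b)` for large `n` since the value group
is archimedean (`exists_pow_valuation_le_of_rankOne`). This is the comparability used in the
proof of Cossart–Piltant 2019 Prop. 4.8 ("`h ∈ A`", v1 p. 53) and in [CoP1] Prop. 8.1 ("Since
`W` has rank one").
[cite: CossartPiltant2019, proof of Prop. 4.8 (arXiv v1: Prop. 4.6, p. 53)]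
[cite: CossartPiltant2008, proof of Prop. 8.1 (HAL p. 23)] -/
theorem exists_forall_mem_pow_valuation_lt (O : ValuationSubring K)
    (hrk : Nonempty O.valuation.RankOne) (hAO : ∀ x : A, algebraMap A K x ∈ O)
    (hdom : ∀ x ∈ maximalIdeal A, O.valuation (algebraMap A K x) < 1) {b : K} (hb : b ≠ 0) :
    ∃ n : ℕ, ∀ y ∈ maximalIdeal A ^ n, O.valuation (algebraMap A K y) < O.valuation b := by
  classical
  obtain ⟨s, hs⟩ := (maximalIdeal A).fg_of_isNoetherianRing
  -- `c = max v(gᵢ)` over the generators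
  set c := s.sup fun g => O.valuation (algebraMap A K g) with hc
  have hsm : ∀ g ∈ s, g ∈ maximalIdeal A := fun g hg => hs ▸ Ideal.subset_span hg
  have hc1 : c < 1 := by
    rw [hc, Finset.sup_lt_iff (lt_of_le_of_lt bot_le zero_lt_one)]
    exact fun g hg => hdom g (hsm g hg)
  -- the ideals `J γ = {x | v(x) ≤ γ}`
  have hA1 : ∀ x : A, O.valuation (algebraMap A K x) ≤ 1 := fun x =>
    (O.valuation_le_one_iff _).mpr (hAO x)
  let J : _ → Ideal A := fun γ =>
    { carrier := {x | O.valuation (algebraMap A K x) ≤ γ}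
      zero_mem' := by simp
      add_mem' := fun {x y} hx hy => by
        simp only [Set.mem_setOf_eq, map_add] at hx hy ⊢
        exact (O.valuation.map_add _ _).trans (max_le hx hy)
      smul_mem' := fun r x hx => by
        simp only [Set.mem_setOf_eq, smul_eq_mul, map_mul] at hx ⊢
        exact mul_le_of_le_one_of_le (hA1 r) hx }
  have hmJ : maximalIdeal A ≤ J c := by
    rw [← hs, Ideal.span_le]
    intro g hg
    exact Finset.le_sup (f := fun g => O.valuation (algebraMap A K g)) hg
  have hpow : ∀ n : ℕ, maximalIdeal A ^ n ≤ J (c ^ n) := by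
    intro n
    induction n with
    | zero =>
      intro x _
      change O.valuation (algebraMap A K x) ≤ c ^ 0
      rw [pow_zero]
      exact hA1 x
    | succ n ih =>
      rw [pow_succ, pow_succ]
      refine Ideal.mul_le.mpr fun x hx y hy => ?_
      change O.valuation (algebraMap A K (x * y)) ≤ c ^ n * c
      rw [map_mul, map_mul]
      exact mul_le_mul' (ih hx) (hmJ hy)
  -- archimedean step
  by_cases hc0 : c = 0
  · refine ⟨1, fun y hy => ?_⟩
    have h := hpow 1 hy
    change O.valuation (algebraMap A K y) ≤ c ^ 1 at h
    rw [pow_one, hc0] at h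
    exact lt_of_le_of_lt h (zero_lt_iff.mpr ((Valuation.ne_zero_iff _).mpr hb))
  · have hsne : s.Nonempty := by
      by_contra h
      rw [Finset.not_nonempty_iff_eq_empty] at h
      apply hc0
      rw [hc, h, Finset.sup_empty]; rfl
    obtain ⟨g, hg, hgc⟩ := Finset.exists_mem_eq_sup s hsne fun g => O.valuation (algebraMap A K g)
    have hg1 : O.valuation (algebraMap A K g) < 1 := by rw [← hgc]; exact hc1
    obtain ⟨n, hn⟩ := exists_pow_valuation_le_of_rankOne O hrk (algebraMap A K g) b hb hg1
    have hn' : c ^ n ≤ O.valuation b := by rw [hc, hgc]; exact hn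
    refine ⟨n + 1, fun y hy => ?_⟩
    have h := hpow (n + 1) hy
    change O.valuation (algebraMap A K y) ≤ c ^ (n + 1) at h
    refine lt_of_le_of_lt h (lt_of_lt_of_le ?_ hn')
    exact pow_lt_pow_right_of_lt_one₀ (zero_lt_iff.mpr hc0) hc1 (Nat.lt_succ_self n)

/-- Every element of `Â` is congruent to an element of `A` modulo `𝔪̂ⁿ = 𝔪ⁿ Â` (`A/𝔪ⁿ = Â/𝔪ⁿÂ`,
Matsumura Thm. 8.1; "Since `A` is dense in `Â` for the `m_A`-adic topology", Cossart–Piltant v1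
p. 53).
[cite: Matsumura1987, Thm. 8.1] [cite: CossartPiltant2019, proof of Prop. 4.8 (arXiv v1: Prop. 4.6, p. 53)] -/
private theorem adicCompletion_exists_sub_mem_map_pow
    (x : AdicCompletion (maximalIdeal A) A) (n : ℕ) :
    ∃ a : A, x - algebraMap A (AdicCompletion (maximalIdeal A) A) a ∈
      (maximalIdeal A ^ n).map (algebraMap A (AdicCompletion (maximalIdeal A) A)) := by
  obtain ⟨a, ha⟩ := Ideal.Quotient.mk_surjective (AdicCompletion.evalₐ (maximalIdeal A) n x)
  refine ⟨a, ?_⟩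
  rw [Ideal.map_pow]
  exact AdicCompletion.sub_of_mem_pow_map_of_evalₐ_eq (maximalIdeal A)
    (maximalIdeal A).fg_of_isNoetherianRing x a ha.symm

/-- **Dichotomy for the values of `Â` under an extension of a rank-one valuation** (the
mechanism behind Cossart–Piltant's "it is not necessary to assume here that `dim 𝒪_v̂ = 1`
because `h ∈ A`" and the density step (511)–(512)). Let `(A, 𝔪)` be Noetherian local, `O` a
rank-one valuation ring of the field `K ⊇ A` centred on `𝔪`, `ι : K → K₁` compatible with
`A → Â → K₁`, and `O'` a valuation ring of `K₁` containing the image of `Â` with `O' ∩ K = O`.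
Then for every `x ∈ Â`: EITHER `v̂(x) = v̂(ι a)` for some `a ∈ A` (write `x ≡ a mod 𝔪ⁿÂ` with
`v(𝔪ⁿ) > v(b)` for a `b ∈ K^×` with `v̂(x) ≤ v(b)`: the error has value beyond `v̂(x)`), OR
`v̂(x) > v(b)` for every `b ∈ K^×` (in Mathlib's order: `valuation x < valuation (ι b)`).
[cite: CossartPiltant2019, proof of Prop. 4.8 with Lemma 4.7 (arXiv v1: Prop. 4.6, p. 53)] -/
theorem valuation_adicCompletion_eq_or_lt (O : ValuationSubring K)
    (hrk : Nonempty O.valuation.RankOne) (hAO : ∀ x : A, algebraMap A K x ∈ O)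
    (hdom : ∀ x ∈ maximalIdeal A, O.valuation (algebraMap A K x) < 1)
    {K₁ : Type w} [Field K₁] [Algebra (AdicCompletion (maximalIdeal A) A) K₁]
    (ι : K →+* K₁) (hι : ι.comp (algebraMap A K) =
      (algebraMap (AdicCompletion (maximalIdeal A) A) K₁).comp
        (algebraMap A (AdicCompletion (maximalIdeal A) A)))
    (O' : ValuationSubring K₁)
    (hRO' : ∀ x : AdicCompletion (maximalIdeal A) A, algebraMap _ K₁ x ∈ O')
    (hO : O'.comap ι = O) (x : AdicCompletion (maximalIdeal A) A) :
    (∃ a : A, O'.valuation (algebraMap _ K₁ x) = O'.valuation (ι (algebraMap A K a))) ∨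
      (∀ b : K, b ≠ 0 → O'.valuation (algebraMap _ K₁ x) < O'.valuation (ι b)) := by
  classical
  -- `v` and `v̂ ∘ ι` are equivalent valuations of `K`
  have hequiv : O.valuation.IsEquiv (O'.valuation.comap ι) := by
    rw [Valuation.isEquiv_iff_valuationSubring, ValuationSubring.valuationSubring_valuation]
    ext y
    rw [Valuation.mem_valuationSubring_iff, Valuation.comap_apply,
      ValuationSubring.valuation_le_one_iff, ← ValuationSubring.mem_comap, hO]
  have hιA : ∀ a : A, algebraMap (AdicCompletion (maximalIdeal A) A) K₁ (algebraMap A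
      (AdicCompletion (maximalIdeal A) A) a) = ι (algebraMap A K a) := fun a => by
    have := RingHom.congr_fun hι a
    simpa only [RingHom.comp_apply] using this.symm
  by_cases h : ∀ b : K, b ≠ 0 → O'.valuation (algebraMap
      (AdicCompletion (maximalIdeal A) A) K₁ x) < O'.valuation (ι b)
  · exact Or.inr h
  left
  push Not at h
  obtain ⟨b, hb, hbx⟩ := h
  -- `v(𝔪ⁿ) > v(b)` and `x ≡ a mod 𝔪ⁿ Â`
  obtain ⟨n, hn⟩ := exists_forall_mem_pow_valuation_lt O hrk hAO hdom hb
  obtain ⟨a, ha⟩ := adicCompletion_exists_sub_mem_map_pow x n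
  -- every element of `𝔪ⁿ Â` has `v̂`-value beyond `v(b)`
  let J : Ideal (AdicCompletion (maximalIdeal A) A) :=
    { carrier := {z | O'.valuation (algebraMap
        (AdicCompletion (maximalIdeal A) A) K₁ z) < O'.valuation (ι b)}
      zero_mem' := by
        simp only [Set.mem_setOf_eq, map_zero]
        exact zero_lt_iff.mpr ((Valuation.ne_zero_iff _).mpr ((map_ne_zero ι).mpr hb))
      add_mem' := fun {y z} hy hz => by
        simp only [Set.mem_setOf_eq, map_add] at hy hz ⊢
        exact lt_of_le_of_lt (O'.valuation.map_add _ _) (max_lt hy hz)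
      smul_mem' := fun r z hz => by
        simp only [Set.mem_setOf_eq, smul_eq_mul, map_mul] at hz ⊢
        exact mul_lt_of_le_one_of_lt ((O'.valuation_le_one_iff _).mpr (hRO' r)) hz }
  have hJ : (maximalIdeal A ^ n).map (algebraMap A (AdicCompletion (maximalIdeal A) A)) ≤ J := by
    rw [Ideal.map_le_iff_le_comap]
    intro y hy
    change O'.valuation (algebraMap (AdicCompletion (maximalIdeal A) A) K₁ (algebraMap A
        (AdicCompletion (maximalIdeal A) A) y)) < O'.valuation (ι b)
    rw [hιA]
    exact (hequiv.lt_iff_lt).mp (hn y hy)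
  have hr : O'.valuation (algebraMap (AdicCompletion (maximalIdeal A) A) K₁ (x - algebraMap A
      (AdicCompletion (maximalIdeal A) A) a)) < O'.valuation (ι b) := hJ ha
  -- hence `v̂(x) = v̂(a)`
  refine ⟨a, ?_⟩
  have hlt : O'.valuation (algebraMap (AdicCompletion (maximalIdeal A) A) K₁ (x - algebraMap A
      (AdicCompletion (maximalIdeal A) A) a)) <
      O'.valuation (algebraMap (AdicCompletion (maximalIdeal A) A) K₁ x) := lt_of_lt_of_le hr hbx
  have := Valuation.map_sub_eq_of_lt_left O'.valuation hlt
  rw [← map_sub, sub_sub_cancel, hιA] at this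
  exact this.symm


/-- **The prime of infinitely large values.** In the situation of `valuation_adicCompletion_eq_or_lt`
(`(A, 𝔪)` Noetherian local, `O` a rank-one valuation ring of `K ⊇ A` centred on `𝔪`, `ι : K → K₁`
compatible with `A → Â → K₁`, `O' ⊇ Â` a valuation ring of `K₁` with `O' ∩ K = O`), the elements of
`Â` whose `v̂`-value exceeds `v(b)` for every `b ∈ K^×` form a PRIME ideal of `Â`; it contains the
kernel of `Â → K₁` (the chosen formal branch `P̂₁`) and no element of `A` that is non-zero in `K`.
(It is the centre on `Â` of the coarsening of `v̂` by the convex hull of `Γ_v`; `P̂₁ ⊊` this prime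
exactly when "`dim 𝒪_v̂ ≥ 1` … is strict", Cossart–Piltant v1 p. 53.) Primality: if `x, y` are not in
it, the dichotomy gives `v̂(x) = v(a)`, `v̂(y) = v(a')` with `a, a' ≠ 0` in `K`, so
`v̂(xy) = v(aa')` is not beyond `v(aa')`.
[cite: CossartPiltant2019, proof of Prop. 4.8 (arXiv v1: Prop. 4.6, p. 53)] -/
theorem exists_isPrime_valuation_adicCompletion_lt_forall (O : ValuationSubring K)
    (hrk : Nonempty O.valuation.RankOne) (hAO : ∀ x : A, algebraMap A K x ∈ O)
    (hdom : ∀ x ∈ maximalIdeal A, O.valuation (algebraMap A K x) < 1)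
    {K₁ : Type w} [Field K₁] [Algebra (AdicCompletion (maximalIdeal A) A) K₁]
    (ι : K →+* K₁) (hι : ι.comp (algebraMap A K) =
      (algebraMap (AdicCompletion (maximalIdeal A) A) K₁).comp
        (algebraMap A (AdicCompletion (maximalIdeal A) A)))
    (O' : ValuationSubring K₁)
    (hRO' : ∀ x : AdicCompletion (maximalIdeal A) A, algebraMap _ K₁ x ∈ O')
    (hO : O'.comap ι = O) :
    ∃ P : Ideal (AdicCompletion (maximalIdeal A) A), P.IsPrime ∧
      (∀ x, x ∈ P ↔ ∀ b : K, b ≠ 0 → O'.valuation (algebraMap _ K₁ x) < O'.valuation (ι b)) ∧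
      RingHom.ker (algebraMap (AdicCompletion (maximalIdeal A) A) K₁) ≤ P ∧
      ∀ a : A, algebraMap A K a ≠ 0 → algebraMap A (AdicCompletion (maximalIdeal A) A) a ∉ P := by
  classical
  have hιA : ∀ a : A, algebraMap (AdicCompletion (maximalIdeal A) A) K₁
      (algebraMap A (AdicCompletion (maximalIdeal A) A) a) = ι (algebraMap A K a) := fun a => by
    have := RingHom.congr_fun hι a
    simpa only [RingHom.comp_apply] using this.symm
  have hpos : ∀ b : K, b ≠ 0 → 0 < O'.valuation (ι b) := fun b hb =>
    zero_lt_iff.mpr ((Valuation.ne_zero_iff _).mpr ((map_ne_zero ι).mpr hb))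
  let P : Ideal (AdicCompletion (maximalIdeal A) A) :=
    { carrier := {x | ∀ b : K, b ≠ 0 →
        O'.valuation (algebraMap (AdicCompletion (maximalIdeal A) A) K₁ x) < O'.valuation (ι b)}
      zero_mem' := fun b hb => by
        simp only [map_zero]
        exact hpos b hb
      add_mem' := fun {y z} hy hz b hb => by
        rw [map_add]
        exact lt_of_le_of_lt (O'.valuation.map_add _ _) (max_lt (hy b hb) (hz b hb))
      smul_mem' := fun r z hz b hb => by
        rw [smul_eq_mul, map_mul, map_mul]
        exact mul_lt_of_le_one_of_lt ((O'.valuation_le_one_iff _).mpr (hRO' r)) (hz b hb) }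
  have hmem : ∀ x, x ∈ P ↔ ∀ b : K, b ≠ 0 →
      O'.valuation (algebraMap _ K₁ x) < O'.valuation (ι b) := fun x => Iff.rfl
  -- an element outside `P` has the value of a non-zero element of `K`
  have hout : ∀ x, x ∉ P → ∃ a : A, algebraMap A K a ≠ 0 ∧
      O'.valuation (algebraMap _ K₁ x) = O'.valuation (ι (algebraMap A K a)) := by
    intro x hx
    rcases valuation_adicCompletion_eq_or_lt O hrk hAO hdom ι hι O' hRO' hO x with ⟨a, ha⟩ | h
    · refine ⟨a, fun ha0 => hx ((hmem x).mpr fun b hb => ?_), ha⟩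
      rw [ha, ha0, map_zero, map_zero]
      exact hpos b hb
    · exact absurd ((hmem x).mpr h) hx
  refine ⟨P, ⟨?_, ?_⟩, hmem, ?_, ?_⟩
  · -- `1 ∉ P`
    rw [Ideal.ne_top_iff_one]
    intro h1
    have := (hmem 1).mp h1 1 one_ne_zero
    rw [map_one, map_one, map_one] at this
    exact lt_irrefl _ this
  · -- prime
    intro x y hxy
    by_contra hcon
    push Not at hcon
    obtain ⟨a, ha0, ha⟩ := hout x hcon.1
    obtain ⟨a', ha0', ha'⟩ := hout y hcon.2
    have hb : algebraMap A K a * algebraMap A K a' ≠ 0 := mul_ne_zero ha0 ha0'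
    have := (hmem _).mp hxy _ hb
    rw [map_mul, map_mul, ha, ha', map_mul, map_mul] at this
    exact lt_irrefl _ this
  · -- the kernel
    intro x hx b hb
    rw [RingHom.mem_ker] at hx
    change O'.valuation (algebraMap _ K₁ x) < _
    rw [hx, map_zero]
    exact hpos b hb
  · -- elements of `A`
    intro a ha0 haP
    have := (hmem _).mp haP (algebraMap A K a) ha0
    rw [hιA] at this
    exact lt_irrefl _ this


/-- **Archimedean comparability for fractions with a `K`-finite denominator** — the form in which
Cossart–Piltant's remark «it is not necessary to assume here that `dim 𝒪_v̂ = 1` because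
`h ∈ A`» feeds the `E = F` loop of [CoP1] Prop. 8.1 («Since `W` has rank one, we have
`n W y_{i₂} ≥ W y_{i₁}` for some `n ≥ 1`») when `v̂` has higher rank. In the situation of
`valuation_adicCompletion_eq_or_lt`, let `y = x₁/x₂ ∈ K̂₁` with `x₁, x₂ ∈ Â`, the denominator `x₂`
having `v̂`-value at most `v(b)` for some `b ∈ K^×` (a "`K`-finite" element), and `v̂(y) > 0`.
Then for every `c ∈ K^×` some power of `v̂(y)` passes `v(c)`: by the dichotomy `v̂(x₂) = v(a₂)`;
if also `v̂(x₁) = v(a₁)` then `v̂(y) = v(a₁/a₂)` and the value group of the rank-one `v` is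
archimedean (`exists_pow_valuation_le_of_rankOne`); otherwise `v̂(x₁)`, hence `v̂(y)`, is beyond
every `v(c)`. (With `c := h` and `y_{i₁} ∣ h`: `n·v̂(y_{i₂}) ≥ v(h) ≥ v̂(y_{i₁})`.)
[cite: CossartPiltant2019, proof of Prop. 4.8 with Lemma 4.7 (arXiv v1: Prop. 4.6, p. 53)]
[cite: CossartPiltant2008, proof of Prop. 8.1 (HAL p. 23)] -/
theorem exists_pow_valuation_div_le_of_finite_denominator (O : ValuationSubring K)
    (hrk : Nonempty O.valuation.RankOne) (hAO : ∀ x : A, algebraMap A K x ∈ O)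
    (hdom : ∀ x ∈ maximalIdeal A, O.valuation (algebraMap A K x) < 1)
    {K₁ : Type w} [Field K₁] [Algebra (AdicCompletion (maximalIdeal A) A) K₁]
    (ι : K →+* K₁) (hι : ι.comp (algebraMap A K) =
      (algebraMap (AdicCompletion (maximalIdeal A) A) K₁).comp
        (algebraMap A (AdicCompletion (maximalIdeal A) A)))
    (O' : ValuationSubring K₁)
    (hRO' : ∀ x : AdicCompletion (maximalIdeal A) A, algebraMap _ K₁ x ∈ O')
    (hO : O'.comap ι = O) (x₁ x₂ : AdicCompletion (maximalIdeal A) A)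
    (hx₂ : ∃ b : K, b ≠ 0 ∧ O'.valuation (ι b) ≤ O'.valuation (algebraMap _ K₁ x₂))
    (hy : O'.valuation (algebraMap _ K₁ x₁ / algebraMap _ K₁ x₂) < 1) (c : K) (hc : c ≠ 0) :
    ∃ n : ℕ, O'.valuation (algebraMap _ K₁ x₁ / algebraMap _ K₁ x₂) ^ n ≤ O'.valuation (ι c) := by
  classical
  have hequiv : O.valuation.IsEquiv (O'.valuation.comap ι) := by
    rw [Valuation.isEquiv_iff_valuationSubring, ValuationSubring.valuationSubring_valuation]
    ext y
    rw [Valuation.mem_valuationSubring_iff, Valuation.comap_apply,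
      ValuationSubring.valuation_le_one_iff, ← ValuationSubring.mem_comap, hO]
  have hιA : ∀ a : A, algebraMap (AdicCompletion (maximalIdeal A) A) K₁
      (algebraMap A (AdicCompletion (maximalIdeal A) A) a) = ι (algebraMap A K a) := fun a => by
    have := RingHom.congr_fun hι a
    simpa only [RingHom.comp_apply] using this.symm
  have hpos : ∀ b : K, b ≠ 0 → 0 < O'.valuation (ι b) := fun b hb =>
    zero_lt_iff.mpr ((Valuation.ne_zero_iff _).mpr ((map_ne_zero ι).mpr hb))
  obtain ⟨b, hb, hbx₂⟩ := hx₂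
  -- the denominator has the value of a non-zero `a₂ ∈ A`
  obtain ⟨a₂, ha₂⟩ : ∃ a₂ : A, O'.valuation (algebraMap _ K₁ x₂) =
      O'.valuation (ι (algebraMap A K a₂)) := by
    rcases valuation_adicCompletion_eq_or_lt O hrk hAO hdom ι hι O' hRO' hO x₂ with ⟨a, ha⟩ | h
    · exact ⟨a, ha⟩
    · exact absurd (h b hb) (not_lt.mpr hbx₂)
  have ha₂0 : algebraMap A K a₂ ≠ 0 := by
    intro h0
    rw [h0, map_zero, map_zero] at ha₂
    exact (lt_irrefl _) (lt_of_lt_of_le (hpos b hb) (hbx₂.trans ha₂.le))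
  have hva₂ : 0 < O'.valuation (ι (algebraMap A K a₂)) := hpos _ ha₂0
  set y := algebraMap (AdicCompletion (maximalIdeal A) A) K₁ x₁ /
    algebraMap (AdicCompletion (maximalIdeal A) A) K₁ x₂ with hydef
  have hvy : O'.valuation y = O'.valuation (algebraMap _ K₁ x₁) /
      O'.valuation (ι (algebraMap A K a₂)) := by
    rw [hydef, map_div₀, ha₂]
  rcases valuation_adicCompletion_eq_or_lt O hrk hAO hdom ι hι O' hRO' hO x₁ with ⟨a₁, ha₁⟩ | h₁
  · -- `v̂(y) = v(a₁/a₂)`, a value of the rank-one valuation `v`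
    set q : K := algebraMap A K a₁ / algebraMap A K a₂ with hqdef
    have hyq : O'.valuation y = O'.valuation (ι q) := by
      rw [hvy, ha₁, hqdef, map_div₀, map_div₀]
    by_cases hq0 : q = 0
    · refine ⟨1, ?_⟩
      rw [pow_one, hyq, hq0, map_zero, map_zero]
      exact zero_le
    have hq1 : O.valuation q < 1 := by
      have h' : (O'.valuation.comap ι) q < (O'.valuation.comap ι) 1 := by
        rw [Valuation.comap_apply, Valuation.comap_apply, map_one, map_one, ← hyq]
        exact hy
      have := (hequiv.lt_iff_lt).mpr h'
      rwa [map_one] at this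
    obtain ⟨n, hn⟩ := exists_pow_valuation_le_of_rankOne O hrk q c hc hq1
    refine ⟨n, ?_⟩
    have h' : O.valuation (q ^ n) ≤ O.valuation c := by rwa [map_pow]
    have h'' := (hequiv (q ^ n) c).mp h'
    rw [Valuation.comap_apply, Valuation.comap_apply, map_pow, map_pow] at h''
    rwa [hyq]
  · -- `v̂(x₁)` is infinitely large, hence so is `v̂(y)`
    refine ⟨1, ?_⟩
    rw [pow_one, hvy]
    have h := h₁ (c * algebraMap A K a₂) (mul_ne_zero hc ha₂0)
    rw [map_mul, map_mul] at h
    exact ((div_lt_iff₀ hva₂).mpr h).le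

end Literature.AlgebraicGeometry.Resolution

end
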